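import Mathlib
import Literature.Analysis.FluidPDE.PressurePoisson
import Literature.Analysis.FluidPDE.LerayProfileCalculus
import Literature.Analysis.FluidPDE.SubMeanValue
import HarnessLib

/-!
# The pressure Laplacian as vorticity minus strain (`Q`-criterion) and the sub-mean-value reading:
# pressure peaks of incompressible flows are strain-dominated

For a classical incompressible Navier–Stokes / Euler solution on `ℝ³` (any viscosity, force with divergence-free
slices) the pressure Poisson equation `Δp = −div((u·∇)u) = −tr((∇u)²)` (Tao 2011, (8); tree
`laplacian_pressure_eq_of_isClassicalNSSolutionOn`, `divergence_convect_self_eq`) combines with the pointwise algebra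
`|∇u|²_F = |curl u|² + tr(∇u ∘ ∇u)` (tree `frobeniusNormSq_fderiv_eq_sq_norm_curl_add_trace`) into

* `laplacian_pressure_eq_sq_norm_curl_sub_frobeniusNormSq` — `Δp(t,x) = |curl u(t,x)|² − |∇u(t,x)|²_F`
  (`= ½|ω|² − |S|² = 2Q` in the notation of the `Q`-criterion of Hunt–Wray–Moin / Jeong–Hussain);

and, through the exact mean-value defect identity for the unit-mass probe bump (`exists_probeBump_defect_eq`),

* `pressure_defect_eq_strainExcess_of_isClassicalNSSolutionOn` — `p(x₀) − ∫χ_R p(x₀+·) = ∫₀¹ s ∫ Q_R(y)(|∇u|²_F − |curl u|²)(x₀ + s y)`;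
* `exists_strainDominated_near_pressure_excess_of_isClassicalNSSolutionOn` — a point where the pressure exceeds its
  `χ_R`-average by a positive amount has a STRAIN-DOMINATED point (`|curl u|² < |∇u|²_F`, i.e. `Q < 0`) within `2R`.

(The self-similar-profile versions live in `Summits/…/EulerZoomLiouvillePowerGaugeEulerLiouvilleSelfSimilarPressureStrainExcess`.)
-/

noncomputable section

open MeasureTheory Set Filter Topology Metric Function InnerProductSpace
open scoped RealInnerProductSpace Laplacian

namespace Literature.Analysis.FluidPDE

/-- **`Δp = |curl u|² − |∇u|²_F` for classical incompressible flows on `ℝ³`** (any viscosity `ν`; force with divergence-free slice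
at time `t`): the pressure Poisson equation `Δp = −div((u·∇)u) + div f` with `div((u·∇)u) = tr((∇u)²)` for a divergence-free field and
`|∇u|²_F = |curl u|² + tr(∇u ∘ ∇u)`.  Twice the `Q`-criterion quantity `Q = ½(|Ω|² − |S|²)`. [cite: Tao2011, (8)] -/
theorem laplacian_pressure_eq_sq_norm_curl_sub_frobeniusNormSq {S : Set ℝ} {ν : ℝ}
    {f u : ℝ → EuclideanSpace ℝ (Fin 3) → EuclideanSpace ℝ (Fin 3)} {p : ℝ → EuclideanSpace ℝ (Fin 3) → ℝ}
    (h : IsClassicalNSSolutionOn S ν f u p) {t : ℝ} (ht : t ∈ interior S)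
    (hdivf : ∀ x, VectorCalculus.divergence (f t) x = 0) (x : EuclideanSpace ℝ (Fin 3)) :
    (Δ (p t)) x = ‖curl (u t) x‖ ^ 2 - frobeniusNormSq (fderiv ℝ (u t) x) := by
  have hu : ContDiff ℝ 2 (u t) := contDiff_infty.1 (h.contDiff_velocity (interior_subset ht)) 2
  rw [laplacian_pressure_eq_of_isClassicalNSSolutionOn h ht x, hdivf x, add_zero,
    divergence_convect_self_eq hu (h.divFree t (interior_subset ht)) x,
    frobeniusNormSq_fderiv_eq_sq_norm_curl_add_trace]
  ring

/-- **PRESSURE DEFECT = POSITIVE AVERAGE OF THE STRAIN EXCESS** for classical incompressible flows on `ℝ³`: at an interior time `t`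
(force slice divergence free) and for every radius `R > 0` there is an explicit kernel `0 ≤ Q ≤ 2R²(m R³)⁻¹` supported in `‖y‖ ≤ 2R`
with `p(t,x₀) − ∫ χ_R(y) p(t, x₀+y) dy = ∫₀¹ s ∫ Q(y)(|∇u|²_F − |curl u|²)(t, x₀ + s y) dy ds` for every `x₀`
(`exists_probeBump_defect_eq` + `laplacian_pressure_eq_sq_norm_curl_sub_frobeniusNormSq`). [cite: GilbargTrudinger2001, Thm. 2.1] -/
theorem pressure_defect_eq_strainExcess_of_isClassicalNSSolutionOn {S : Set ℝ} {ν : ℝ}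
    {f u : ℝ → EuclideanSpace ℝ (Fin 3) → EuclideanSpace ℝ (Fin 3)} {p : ℝ → EuclideanSpace ℝ (Fin 3) → ℝ}
    (h : IsClassicalNSSolutionOn S ν f u p) {t : ℝ} (ht : t ∈ interior S)
    (hdivf : ∀ x, VectorCalculus.divergence (f t) x = 0) {R : ℝ} (hR : 0 < R) :
    ∃ Q : EuclideanSpace ℝ (Fin 3) → ℝ, Continuous Q ∧ (∀ y, 0 ≤ Q y) ∧ (∀ y, 2 * R ≤ ‖y‖ → Q y = 0) ∧
      (∀ y, Q y ≤ 2 * R ^ 2 * (baseBumpMass (EuclideanSpace ℝ (Fin 3)) *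
        R ^ Module.finrank ℝ (EuclideanSpace ℝ (Fin 3)))⁻¹) ∧
      ∀ x₀ : EuclideanSpace ℝ (Fin 3), p t x₀ - (∫ y, probeBump R y * p t (x₀ + y)) =
        ∫ s in (0 : ℝ)..1, s * ∫ y, Q y *
          (frobeniusNormSq (fderiv ℝ (u t) (x₀ + s • y)) - ‖curl (u t) (x₀ + s • y)‖ ^ 2) := by
  have hp2 : ContDiff ℝ 2 (p t) := contDiff_infty.1 (h.contDiff_pressure (interior_subset ht)) 2
  obtain ⟨Q, hQc, hQ0, hQsupp, hQle, hid⟩ := exists_probeBump_defect_eq hp2 hR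
  refine ⟨Q, hQc, hQ0, hQsupp, hQle, fun x₀ => ?_⟩
  rw [hid x₀]
  refine intervalIntegral.integral_congr fun s _ => ?_
  congr 1
  refine integral_congr_ae (Eventually.of_forall fun y => ?_)
  simp only [laplacian_pressure_eq_sq_norm_curl_sub_frobeniusNormSq h ht hdivf, neg_sub]

/-- **PRESSURE PEAKS ARE STRAIN-DOMINATED** (sub-mean-value reading of the `Q`-criterion): for a classical incompressible flow on `ℝ³`
at an interior time (force slice divergence free), if the pressure at `x₀` exceeds its `χ_R`-average by a positive amount,
`δ + ∫ χ_R(y) p(t, x₀+y) dy ≤ p(t, x₀)` with `δ > 0`, then some `z ∈ B_{2R}(x₀)` is strain-dominated: `|curl u(t,z)|² < |∇u(t,z)|²_F`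
(`|S|² > ½|ω|²`, the `Q < 0` region).  In particular a strict local maximum of the pressure is approached by strain-dominated points.
[cite: GilbargTrudinger2001, Thm. 2.1] -/
theorem exists_strainDominated_near_pressure_excess_of_isClassicalNSSolutionOn {S : Set ℝ} {ν : ℝ}
    {f u : ℝ → EuclideanSpace ℝ (Fin 3) → EuclideanSpace ℝ (Fin 3)} {p : ℝ → EuclideanSpace ℝ (Fin 3) → ℝ}
    (h : IsClassicalNSSolutionOn S ν f u p) {t : ℝ} (ht : t ∈ interior S)
    (hdivf : ∀ x, VectorCalculus.divergence (f t) x = 0) {R : ℝ} (hR : 0 < R) (x₀ : EuclideanSpace ℝ (Fin 3))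
    {δ : ℝ} (hδ : 0 < δ) (hex : δ + (∫ y, probeBump R y * p t (x₀ + y)) ≤ p t x₀) :
    ∃ z ∈ ball x₀ (2 * R), ‖curl (u t) z‖ ^ 2 < frobeniusNormSq (fderiv ℝ (u t) z) := by
  obtain ⟨Q, -, hQ0, hQsupp, -, hid⟩ := pressure_defect_eq_strainExcess_of_isClassicalNSSolutionOn h ht hdivf hR
  have hmass : δ ≤ ∫ s in (0 : ℝ)..1, s * ∫ y, Q y *
      (frobeniusNormSq (fderiv ℝ (u t) (x₀ + s • y)) - ‖curl (u t) (x₀ + s • y)‖ ^ 2) := by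
    rw [← hid x₀]; linarith
  by_contra hno
  push Not at hno
  have hinner : ∀ s ∈ Icc (0 : ℝ) 1, ∫ y, Q y *
      (frobeniusNormSq (fderiv ℝ (u t) (x₀ + s • y)) - ‖curl (u t) (x₀ + s • y)‖ ^ 2) ≤ 0 := by
    intro s hs
    refine integral_nonpos fun y => ?_
    by_cases hy : ‖y‖ < 2 * R
    · have hz : x₀ + s • y ∈ ball x₀ (2 * R) := by
        rw [mem_ball, dist_eq_norm, add_sub_cancel_left, norm_smul, Real.norm_of_nonneg hs.1]
        nlinarith [hs.2, norm_nonneg y]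
      exact mul_nonpos_of_nonneg_of_nonpos (hQ0 y) (by linarith [hno _ hz])
    · rw [hQsupp y (not_lt.1 hy), zero_mul]
      exact le_rfl
  have hout : ∫ s in (0 : ℝ)..1, s * ∫ y, Q y *
      (frobeniusNormSq (fderiv ℝ (u t) (x₀ + s • y)) - ‖curl (u t) (x₀ + s • y)‖ ^ 2) ≤ 0 := by
    have hneg : 0 ≤ ∫ s in (0 : ℝ)..1, -(s * ∫ y, Q y *
        (frobeniusNormSq (fderiv ℝ (u t) (x₀ + s • y)) - ‖curl (u t) (x₀ + s • y)‖ ^ 2)) :=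
      intervalIntegral.integral_nonneg zero_le_one fun s hs =>
        neg_nonneg.2 (mul_nonpos_of_nonneg_of_nonpos hs.1 (hinner s hs))
    rw [intervalIntegral.integral_neg] at hneg
    linarith
  linarith

end Literature.Analysis.FluidPDE

end
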